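import Summits.QuantumFields.BalabanUV.T4Continuum.Support.NE7HintOfLocalChartWideDecSlice
import Summits.QuantumFields.BalabanUV.T4Continuum.Support.NE7OneStepOfRoutePi
import HarnessLib

/-!
# GEN 99 RE-THREAD (`…Slice`, Bałaban-slice road, memo `t4/b2b-balaban-t4-ne7-p1-g99/ROAD-G99.md` §3.5 ∕ §3.8): this file is `NE7HintOfLocalChartSU2WideDec`'s CHAIN THEOREM VERBATIM except that
# the slice `T_♮(U♯) = frameFreeBlockLandauW` of the per-pair binder is replaced by an ABSTRACT SLICE FAMILY `𝒯 k U♯` with the two hypotheses (hT) «tangent-critical ⟹ critical on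
# `𝒯 j W`» and (hP) «class SlicePoincare for `𝒯 j W`» in the generic theorems, and by the corner-free energy block-Landau slice `𝒯_E = energyBlockLandauW` (both hypotheses
# DISCHARGED: `hT_energyBlockLandau`, `classSlicePoincare_energyBlockLandau_SU2`, constant `8·CPLine 4 2 2 10⁻¹⁷ 10⁻⁵³ + 1`) in the SU(2) `d = 4` `L = 2` theorems; chain predecessors are
# the `…Slice` ∕ `…GenericSlice` re-issues (lineage `b2b-balaban-t4-ne7-p1` gen 99, CRUX PROVER NE7 #1).  NOT NE7; spine 0∕9.  Original docstring follows.

# GEN 95 RE-THREAD (`…Dec`): this file is `NE7HintOfLocalChartSU2Wide` VERBATIM except that F31's per-pair binder `hleaves` (row NE3's weight currency,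
# numerically refuted for arbitrary pairs — memo `t4/b2b-balaban-t4-ne7-p1-g95/WEIGHT-CURRENCY-DEAD.md`) is replaced by F327's honest binder `hdecomp`
# (decomposition `X = X_T + X_N` with its two energy letters and k-free currencies `(α̂, ν̂, κ̂)`) and route Π's uniform block by ONE k-free line;
# the chart∕budget content is untouched and chain predecessors are the `…Dec` re-issues.  Original docstring follows.

# NE7 — (8)∃ from the local chart ON THE WIDE COVER for SU(2)∕U(2) on T⁴ with `L = 2` (F286w)

[Balaban1985Variational] Thm 1 (8) ∘ Prop 8 ∘ [Balaban1983Laplace] Thm 2, row NE7, at `d = 4`, `L = 2`,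
`card n = 2`, `ε ≤ 10⁻⁵³`: F286 `NE7HintOfLocalChartSU2.hint_of_localChart_SU2` VERBATIM except that THE
CHART is asked on the `Kc`-fold cover for a FREE `Kc ≥ 4ℓ + 12` (over F285w `NE7HintOfLocalChartWide`).
WHY (gen 91, `NE7LocalChartCoverObstruction`): at `d = 4`, `L = 2` one has `nbRad 4 2 = 20`, so the chart
ball has radius `(2ℓ + 30)·2^(k+1)` while the half-period of F286's `(4ℓ+12)`-fold cover is
`N(2ℓ + 6)·2^(k+1)`: for `N ≤ 4` (in particular the unit torus `N = 1`) F286's chart hypothesis is a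
GLOBAL chart demand, refuted by torons.  Here the consumer takes `Kc ≥ 4ℓ + 64`, which makes the chart
ball (plus a collar `2·2^(k+1)`) a proper sub-box of the cover torus: the chart is LOCAL, as [B8] Thm 2
at `U₀ = 1` is.  Discharged as in F286: `LevelSmall` (`NE7ConvOneStepSU2.levelSmall_all_d4_L2`) and the
slice Poincaré inequality on the class (`NE3ClassRadiusFamily.classSlicePoincare_SU2'`).  Bill: THE CHART
(constants `≤ A(ℓ+1)^p`, small field `r ≤ ε/4`), row NE3's `hleaves` (at `δ₁ = ε/8`), route Π's two
`k`-free numeric lines.  NE7 is NOT proved unconditionally; nothing of Bałaban's is asserted as an axiom.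
-/

open scoped BigOperators Matrix Matrix.Norms.L2Operator Topology
open NormedSpace Finset Set Filter

namespace Summit.QuantumFields.BalabanUV.T4Continuum.NE7HintOfLocalChartSU2WideDecSlice

open Literature.MathematicalPhysics.QuantumFieldTheory.Balaban1983to89
open B7Prop1Explicit B7Prop2Explicit MatrixLog UnitaryModel
open B4TorusKernel.MultiPeriod (torusSupNorm)
open T4AveragingDeficitWall (IsUnitaryCfg IsSkewDir SmallField vary curl curlSq dirSq dirL1)
open T4AveragingDeficitWallBoundary (IsPeriodicCfg periodBox)
open AveragingDeficitPeriodicCounting (IsPeriodicDir)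
open AveragingDeficitMultiLevelPrep (LevelSmall tower TangentIter)
open BlockAverageVaryHolo (nbRad)
open MinimalActionLevels (perWin)
open MinimalActionSandwich (IsMinimiser admissible)
open MinimalActionRate (sfClass)
open NE3HessForm (dAction)
open NE3SlicePoincareShape (SlicePoincare slicePoincare_mono)
open NE3SlicePoincareBudgetLine (CPLine)
open NE3ClassRadiusFamily (CPLine_nonneg_d4_L2)
open NE7MeanZeroGaugeSliceW (energyBlockLandauW)
open NE7EnergyBlockLandauClassPoincare (classSlicePoincare_energyBlockLandau_SU2)
open NE7ConvOneStepGenericSlice (hT_energyBlockLandau)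
open NE3TangentCovariantTower (dirIter)
open NE3DecomposedRepOfLinearNormalPart (ResidualSliceRepT)
open NE3QbarIterCovLiftPrep (cruxC)
open NE3SmoothRightInverseW (rightInvW)
open NE3RightInverseSolveLetters (thetaLoc)
open NE3RightInverseL2Letter (l2C)
open NE3HatInvCurlLetters (curl2C curl1C)
open NE3EnergyShapes (IsUnitarySite)
open BlockAveragePushDirSplit (flat)
open NE7ConvOneStepSU2 (levelSmall_all_d4_L2)
open NE7HintOfLocalChartWideDecSlice (hint_of_localChart_wide)
open NE3EnergyWeightedShapes (energyNormW)

variable {n : Type*} [Fintype n] [DecidableEq n]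

set_option maxHeartbeats 400000 in
/-- **F286w — (8)∃ from the local chart on the WIDE cover, SU(2)∕U(2) on T⁴, `L = 2`.**  [Balaban1985Variational]
Thm 1 (8) ∘ Prop 8 ∘ [Balaban1983Laplace] Thm 2, rows NE7 ∘ NE3, `card n = 2`: F286's statement with a free
cover factor `Kc ≥ 4ℓ + 12` (take `Kc ≥ 4ℓ + 64` for a LOCAL chart); proof = F286's over F285w. -/
theorem hint_of_localChart_SU2_wide [Nonempty n] (hn : Fintype.card n = 2) {A : ℝ} (hA : 0 ≤ A) (p : ℕ) :
    ∃ ℓ : ℕ, 1 ≤ ℓ ∧ ∃ ε₀ : ℝ, 0 < ε₀ ∧ ∀ ε : ℝ, 0 < ε → ε ≤ ε₀ → ∃ β₀ : ℝ, 0 < β₀ ∧ ∀ β : ℝ, 0 < β → β ≤ β₀ →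
    ∀ (N : ℕ) [NeZero N] (Kc : ℕ) (C₀ C₁ αh νh κh : ℝ), 1 ≤ N → 4 * ℓ + 12 ≤ Kc →
    -- the k-free ceilings `(α̂, ν̂, κ̂)` of the honest per-pair binder and ONE k-free strict line (F327)
    2 * κh < ((((1 / 2 - νh ^ 2) / (2 * (1 + (8 * CPLine 4 2 2 (1 / 10 ^ 17) (1 / 10 ^ 53) + 1))) - νh ^ 2) / 2 - 576 * ((4 : ℕ) : ℝ) * (αh ^ 2 * Real.exp (2 * αh))) / (Fintype.card n : ℝ) - 28 * ((4 : ℕ) : ℝ) * (ε + 7 * αh ^ 2)) →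
    0 ≤ C₀ → C₀ ≤ A * ((ℓ : ℝ) + 1) ^ p → 0 ≤ C₁ → C₁ ≤ A * ((ℓ : ℝ) + 1) ^ p →
    (∀ D : Site 4 → Fin 4 → (Matrix n n ℂ)ˣ, IsUnitaryCfg D → IsPeriodicCfg D ((N * Kc) : ℤ) → SmallField D (4 * (Real.exp β - 1)) →
      ∀ (k : ℕ), ∀ U ∈ admissible (sfClass 4 2 (N * Kc) ε) 2 (k + 1) D,
      (∀ φ : Site 4 → Fin 4 → Matrix n n ℂ, IsSkewDir φ → IsPeriodicDir φ (((N * Kc) * 2 ^ (k + 1) : ℕ) : ℤ) → TangentIter 2 k U φ →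
        dAction U φ (perWin 4 ((N * Kc) * 2 ^ (k + 1))) = 0) →
      ∀ r : ℝ, 0 ≤ r → r ≤ (1 / ((2 : ℕ) : ℝ) ^ 2 * ε) → SmallField U (r / (((2 : ℕ) : ℝ) ^ (k + 1)) ^ 2) →
      ∀ z : Site 4, ∃ (u : Site 4 → (Matrix n n ℂ)ˣ) (At : Site 4 → Fin 4 → Matrix n n ℂ) (a₀ a₁ : ℝ),
        IsUnitarySite u ∧ (∀ (y : Site 4) (i : Fin 4), u (y + (((N * Kc) * 2 ^ (k + 1) : ℕ) : ℤ) • e i) = u y) ∧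
        IsSkewDir At ∧ IsPeriodicDir At (((N * Kc) * 2 ^ (k + 1) : ℕ) : ℤ) ∧ 0 ≤ a₀ ∧ 0 ≤ a₁ ∧
        (∀ (y : Site 4) (κ : Fin 4), ‖At y κ‖ ≤ a₀) ∧ (∀ (y : Site 4) (κ τ : Fin 4), ‖At (y + e τ) κ - At y κ‖ ≤ a₁) ∧
        ((2 : ℕ) : ℝ) ^ (k + 1) * a₀ ≤ C₀ * (r + 4 * (Real.exp β - 1) + ε) ∧ (((2 : ℕ) : ℝ) ^ (k + 1)) ^ 2 * a₁ ≤ C₁ * (r + 4 * (Real.exp β - 1) + ε) ∧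
        (∀ (y : Site 4) (κ : Fin 4),
          torusSupNorm (fun _ : Fin 4 => 2 ^ (k + 1) * (N * Kc)) (y - z) ≤ (((nbRad 4 2 + 2 * ℓ + 10) * 2 ^ (k + 1) : ℕ) : ℝ) →
            gaugeAct u U y κ = vary (flat (d := 4) (n := n)) At 1 y κ)) →
    (∀ D : Site 4 → Fin 4 → (Matrix n n ℂ)ˣ, IsUnitaryCfg D → IsPeriodicCfg D (N : ℤ) → SmallField D (4 * (Real.exp β - 1)) → ∀ (k : ℕ), ∀ Us ∈ admissible (sfClass 4 2 N ε) 2 (k + 1) D, SmallField Us ((1 / ((2 : ℕ) : ℝ) ^ 2 * ε / 2) / (((2 : ℕ) : ℝ) ^ (k + 1)) ^ 2) → (∀ φ : Site 4 → Fin 4 → Matrix n n ℂ, IsSkewDir φ → IsPeriodicDir φ ((N * 2 ^ (k + 1) : ℕ) : ℤ) → TangentIter 2 k Us φ → dAction Us φ (perWin 4 (N * 2 ^ (k + 1))) = 0) → ∀ U' ∈ admissible (sfClass 4 2 N ε) 2 (k + 1) D, 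
      ∃ (u : Site 4 → (Matrix n n ℂ)ˣ) (X XT XN : Site 4 → Fin 4 → Matrix n n ℂ) (α ν κ : ℝ),
        IsUnitarySite u ∧ IsSkewDir X ∧ IsPeriodicDir X ((N * 2 ^ (k + 1) : ℕ) : ℤ) ∧ 0 ≤ α ∧ (∀ x μ, ‖X x μ‖ ≤ α) ∧
        gaugeAct u U' = vary Us X 1 ∧
        X = XT + XN ∧ XT ∈ energyBlockLandauW (d := 4) (n := n) 2 N (k + 1) Us ∧ IsSkewDir XN ∧ 0 ≤ ν ∧
        energyNormW 2 (k + 1) Us XN (periodBox (d := 4) (N * 2 ^ (k + 1)))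
          ≤ ν * energyNormW 2 (k + 1) Us X (periodBox (d := 4) (N * 2 ^ (k + 1))) ∧
        ε / (((2 : ℕ) : ℝ) ^ (k + 1)) ^ 2 * (∑ p ∈ perWin 4 (N * 2 ^ (k + 1)), ‖curl Us XN p‖)
          ≤ κ * energyNormW 2 (k + 1) Us X (periodBox (d := 4) (N * 2 ^ (k + 1))) ^ 2 ∧
        α * ((2 : ℕ) : ℝ) ^ (k + 1) ≤ αh ∧ ν ≤ νh ∧ κ ≤ κh) →
    ∃ δV : ℝ, 0 < δV ∧
      ∀ V ∈ {V : Site 4 → Fin 4 → (Matrix n n ℂ)ˣ | IsUnitaryCfg V ∧ IsPeriodicCfg V (N : ℤ) ∧ SmallField V δV},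
      ∀ k : ℕ, ∃ U : Site 4 → Fin 4 → (Matrix n n ℂ)ˣ, IsMinimiser 4 (sfClass 4 2 N ε) 2 N k V U ∧
        ∃ a : ℝ, 0 ≤ a ∧ a < ε / (((2 : ℕ) : ℝ) ^ k) ^ 2 ∧ SmallField U a := by
  obtain ⟨ℓ, hℓ1, ε₀, hε₀, H⟩ := hint_of_localChart_wide (d := 3) (n := n) (L := 2) (by norm_num) hA p
  refine ⟨ℓ, hℓ1, min ε₀ (1 / 10 ^ 53), lt_min hε₀ (by norm_num), fun ε hε hεle => ?_⟩
  obtain ⟨β₀, hβ₀, H2⟩ := H ε hε (hεle.trans (min_le_left _ _))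
  refine ⟨β₀, hβ₀, ?_⟩
  intro β hβ hβle N _ Kc C₀ C₁ αh νh κh hN hKc hline hC₀ hC₀b hC₁ hC₁b hchart hdecomp
  have hε' : ε ≤ 1 / 10 ^ 53 := hεle.trans (min_le_right _ _)
  have hCP : 0 < 8 * CPLine 4 2 2 (1 / 10 ^ 17) (1 / 10 ^ 53) + 1 := by linarith [CPLine_nonneg_d4_L2]
  have hls := levelSmall_all_d4_L2 hε.le (hε'.trans (by norm_num))
  exact H2 β hβ hβle N Kc (8 * CPLine 4 2 2 (1 / 10 ^ 17) (1 / 10 ^ 53) + 1) C₀ C₁ αh νh κh hN hKc hCP hls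
    (fun j W => energyBlockLandauW (d := 4) (n := n) 2 N (j + 1) W)
    (fun j W hW F htan => hT_energyBlockLandau (by norm_num) hε.le hls j W hW F htan)
    (fun j W hW => slicePoincare_mono (classSlicePoincare_energyBlockLandau_SU2 hn hN hε hε' j W hW) (by linarith))
    hline hC₀ hC₀b hC₁ hC₁b hchart hdecomp

end Summit.QuantumFields.BalabanUV.T4Continuum.NE7HintOfLocalChartSU2WideDecSlice
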